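import Summits.CriticalPhenomena.PercolationContinuityZ3.Theorems.PercNearOneGluingNoHeavyQuantFarSunTKTwoChain
import HarnessLib

/-!
# FAR beyond trees: the law-level symmetrisation for an ARBITRARY symmetric pair weight `W`

builds on p205010 (kernel theorem, internal audit signed; external expert review pending)

Support file (`--supports stmt-CriticalPhenomena-4575`), seat `prim-cert-1` (gen 23); memo `prim-cert-1/FROM-prim-cert-1-g23-SUNFAR-ALL-K.md` §2.
The files `…TKReveal` / `…TKTwoChain` run the law-level symmetrisation for the specific weight `W_{T_K}` of the certificate `T_K`
(`K ≥ 4`).  Here the same argument is recorded for ANY symmetric integer pair weight `W(V, U)` on subsets of `range K`, with the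
purely combinatorial CORE INEQUALITY as the hypothesis:
* the CORE INEQUALITY (hypothesis `hW`) — for all `m ≤ l ≤ K+1`, `a ≤ b ≤ K` and disjoint `Z, T ⊆ range K`:
  `0 ≤ Σ_{J ⊆ T} W(cov l a ∩ (Z ∪ J), cov m b ∩ (Z ∪ T∖J)) + Σ_{J ⊆ T} W(cov l b ∩ (Z ∪ J), cov m a ∩ (Z ∪ T∖J))`
  (a nested pair of arcsets and its suffix swap, sure hairs `Z`, split hairs `T`);
* `TK.corePSG`, `TK.OmegaG`, `TK.revealG_step`, `TK.revealG_nonneg` — hair revealing for `W`;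
* `TK.HHG_nonneg`, **`TK.tcE2_nonneg_of_core`** — the core inequality, `W` symmetric, `g, h ∈ [0,1]` ⟹ `0 ≤ tcE2 K g h W`
  (exchange the suffix variables of the two independent two-chain copies and average).
Used for the small cases (`K = 3`) where `T_K` is not available and a tabulated certificate is checked instead.
No sorries; standard axioms.  Elementary [this work].
-/

noncomputable section

namespace Summit.CriticalPhenomena.PercolationContinuityZ3.Theorems.HairyCycle

namespace TK

open Finset

variable {K : ℕ}

section Reveal

variable (W : Finset ℕ → Finset ℕ → ℤ) (A1 B1 A2 B2 : Finset ℕ)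

/-- The pair sum of the two pairs for given sure-hair sets of the two copies and split hairs `T` (weight `W`). [this work] -/
def corePSG (HA HB T : Finset ℕ) : ℤ :=
  ∑ J ∈ T.powerset, (W (A1 ∩ (HA ∪ J)) (B1 ∩ (HB ∪ (T \ J))) + W (A2 ∩ (HA ∪ J)) (B2 ∩ (HB ∪ (T \ J))))

/-- The hair-averaged quantity `Ω_W(S, Z, T)`: hairs in `S` random in both copies, `Z` sure in both, `T` split. [this work] -/
def OmegaG (h : ℕ → ℝ) (S Z T : Finset ℕ) : ℝ :=
  ∑ Q ∈ S.powerset, ∑ Q' ∈ S.powerset, hw S h Q * hw S h Q' * (corePSG W A1 B1 A2 B2 (Z ∪ Q) (Z ∪ Q') T : ℝ)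

/-- Grouping the two split outcomes of a hair `x ∉ T`. [this work] -/
theorem corePSG_insert {HA HB T : Finset ℕ} {x : ℕ} (hxT : x ∉ T) :
    corePSG W A1 B1 A2 B2 (insert x HA) HB T + corePSG W A1 B1 A2 B2 HA (insert x HB) T = corePSG W A1 B1 A2 B2 HA HB (insert x T) := by
  unfold corePSG
  rw [Finset.sum_powerset_insert hxT, add_comm]
  congr 1
  · refine Finset.sum_congr rfl fun J hJ => ?_
    rw [Finset.mem_powerset] at hJ
    rw [Finset.insert_sdiff_of_notMem _ (fun hx => hxT (hJ hx)), Finset.union_insert, Finset.insert_union]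
  · refine Finset.sum_congr rfl fun J hJ => ?_
    rw [Finset.mem_powerset] at hJ
    rw [Finset.insert_sdiff_insert, Finset.sdiff_insert_of_notMem hxT, Finset.union_insert, Finset.insert_union]

/-- **The revealing identity** for `W`: for `x ∉ S ∪ T`,
`Ω(S+x,Z,T) = (1−h x)²·Ω(S,Z,T) + h x (1−h x)·Ω(S,Z,T+x) + (h x)²·Ω(S,Z+x,T)`. [this work] -/
theorem revealG_step (h : ℕ → ℝ) {S Z T : Finset ℕ} {x : ℕ} (hxS : x ∉ S) (hxT : x ∉ T) :
    OmegaG W A1 B1 A2 B2 h (insert x S) Z T =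
      (1 - h x) ^ 2 * OmegaG W A1 B1 A2 B2 h S Z T + h x * (1 - h x) * OmegaG W A1 B1 A2 B2 h S Z (insert x T) +
        h x ^ 2 * OmegaG W A1 B1 A2 B2 h S (insert x Z) T := by
  classical
  unfold OmegaG
  rw [Finset.sum_powerset_insert hxS]
  have inner : ∀ Q ∈ S.powerset,
      ∑ Q' ∈ (insert x S).powerset, hw (insert x S) h Q * hw (insert x S) h Q' * (corePSG W A1 B1 A2 B2 (Z ∪ Q) (Z ∪ Q') T : ℝ) +
      ∑ Q' ∈ (insert x S).powerset, hw (insert x S) h (insert x Q) * hw (insert x S) h Q' *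
        (corePSG W A1 B1 A2 B2 (Z ∪ insert x Q) (Z ∪ Q') T : ℝ) =
      ∑ Q' ∈ S.powerset, ((1 - h x) ^ 2 * (hw S h Q * hw S h Q' * (corePSG W A1 B1 A2 B2 (Z ∪ Q) (Z ∪ Q') T : ℝ)) +
        h x * (1 - h x) * (hw S h Q * hw S h Q' * (corePSG W A1 B1 A2 B2 (Z ∪ Q) (Z ∪ Q') (insert x T) : ℝ)) +
        h x ^ 2 * (hw S h Q * hw S h Q' * (corePSG W A1 B1 A2 B2 (insert x Z ∪ Q) (insert x Z ∪ Q') T : ℝ))) := by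
    intro Q hQ
    rw [Finset.mem_powerset] at hQ
    rw [Finset.sum_powerset_insert hxS, Finset.sum_powerset_insert hxS, ← Finset.sum_add_distrib, ← Finset.sum_add_distrib,
      ← Finset.sum_add_distrib]
    refine Finset.sum_congr rfl fun Q' hQ' => ?_
    rw [Finset.mem_powerset] at hQ'
    rw [hw_insert_of_not_mem h hxS hQ, hw_insert_of_not_mem h hxS hQ', hw_insert_insert h hxS, hw_insert_insert h hxS]
    have e1 : Z ∪ insert x Q = insert x (Z ∪ Q) := Finset.union_insert x Z Q
    have e2 : Z ∪ insert x Q' = insert x (Z ∪ Q') := Finset.union_insert x Z Q'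
    have e3 : insert x Z ∪ Q = insert x (Z ∪ Q) := Finset.insert_union x Z Q
    have e4 : insert x Z ∪ Q' = insert x (Z ∪ Q') := Finset.insert_union x Z Q'
    rw [e1, e2, e3, e4, ← corePSG_insert W A1 B1 A2 B2 hxT]
    push_cast
    ring
  rw [← Finset.sum_add_distrib, Finset.sum_congr rfl inner]
  simp only [Finset.sum_add_distrib, ← Finset.mul_sum]

end Reveal

/-- **Hair revealing** for `W`: under the core inequality, `Ω_W(S,Z,T) ≥ 0` for pairwise disjoint `S, Z, T ⊆ range K` and the four
arcsets `cov l a, cov m b, cov l b, cov m a` (`m ≤ l ≤ K+1`, `a ≤ b ≤ K`), `h ∈ [0,1]` — induction on `S`. [this work] -/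
theorem revealG_nonneg {W : Finset ℕ → Finset ℕ → ℤ}
    (hW : ∀ l m a b : ℕ, m ≤ l → l ≤ K + 1 → a ≤ b → b ≤ K →
      ∀ Z T : Finset ℕ, Z ⊆ range K → T ⊆ range K → Disjoint Z T →
        0 ≤ (∑ J ∈ T.powerset, W (cov K l a ∩ (Z ∪ J)) (cov K m b ∩ (Z ∪ (T \ J)))) +
          ∑ J ∈ T.powerset, W (cov K l b ∩ (Z ∪ J)) (cov K m a ∩ (Z ∪ (T \ J))))
    {h : ℕ → ℝ} (hh : ∀ k, k < K → 0 ≤ h k ∧ h k ≤ 1) {l m a b : ℕ} (hml : m ≤ l) (hl : l ≤ K + 1) (hab : a ≤ b) (hbK : b ≤ K) :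
    ∀ (S Z T : Finset ℕ), S ⊆ range K → Z ⊆ range K → T ⊆ range K → Disjoint S Z → Disjoint S T → Disjoint Z T →
      0 ≤ OmegaG W (cov K l a) (cov K m b) (cov K l b) (cov K m a) h S Z T := by
  classical
  intro S
  induction S using Finset.induction_on with
  | empty =>
    intro Z T _ hZ hT _ _ hZT
    unfold OmegaG corePSG
    simp only [Finset.powerset_empty, Finset.sum_singleton, Finset.union_empty]
    have h0 : hw (∅ : Finset ℕ) h ∅ = 1 := by unfold hw; simp
    rw [h0, one_mul, one_mul, Finset.sum_add_distrib]
    exact_mod_cast hW l m a b hml hl hab hbK Z T hZ hT hZT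
  | insert x S hxS ih =>
    intro Z T hS hZ hT hSZ hST hZT
    have hxK : x < K := Finset.mem_range.1 (hS (Finset.mem_insert_self x S))
    have hxZ : x ∉ Z := Finset.disjoint_left.1 hSZ (Finset.mem_insert_self x S)
    have hxT : x ∉ T := Finset.disjoint_left.1 hST (Finset.mem_insert_self x S)
    have hS' : S ⊆ range K := (Finset.subset_insert x S).trans hS
    have hSZ' : Disjoint S Z := hSZ.mono_left (Finset.subset_insert x S)
    have hST' : Disjoint S T := hST.mono_left (Finset.subset_insert x S)
    rw [revealG_step _ _ _ _ _ h hxS hxT]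
    have h1 := ih Z T hS' hZ hT hSZ' hST' hZT
    have h2 := ih Z (insert x T) hS' hZ (Finset.insert_subset (Finset.mem_range.2 hxK) hT) hSZ'
      (Finset.disjoint_insert_right.2 ⟨hxS, hST'⟩) (Finset.disjoint_insert_right.2 ⟨hxZ, hZT⟩)
    have h3 := ih (insert x Z) T hS' (Finset.insert_subset (Finset.mem_range.2 hxK) hZ) hT
      (Finset.disjoint_insert_right.2 ⟨hxS, hSZ'⟩) hST' (Finset.disjoint_insert_left.2 ⟨hxT, hZT⟩)
    have hx0 := (hh x hxK).1
    have hx1 := (hh x hxK).2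
    have hx2 : 0 ≤ h x * (1 - h x) := mul_nonneg hx0 (by linarith)
    exact add_nonneg (add_nonneg (mul_nonneg (sq_nonneg _) h1) (mul_nonneg hx2 h2)) (mul_nonneg (sq_nonneg _) h3)

/-! ## From `Ω_W` to the two-copy expectation -/

/-- `corePSG` without split hairs. [this work] -/
theorem corePSG_empty (W : Finset ℕ → Finset ℕ → ℤ) (A1 B1 A2 B2 HA HB : Finset ℕ) :
    corePSG W A1 B1 A2 B2 HA HB ∅ = W (A1 ∩ HA) (B1 ∩ HB) + W (A2 ∩ HA) (B2 ∩ HB) := by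
  unfold corePSG
  rw [Finset.powerset_empty, Finset.sum_singleton, Finset.sdiff_self, Finset.union_empty, Finset.union_empty]

/-- The hair-averaged double pair sum at `(l, m, l', m')` equals `Ω_W` of the four arcsets with all hairs random. [this work] -/
theorem HHG_eq_OmegaG (W : Finset ℕ → Finset ℕ → ℤ) (h : ℕ → ℝ) (l m l' m' : ℕ) :
    ∑ Q ∈ (range K).powerset, ∑ Q' ∈ (range K).powerset, hairW K h Q * hairW K h Q' *
      ((W (Q ∩ cov K l l') (Q' ∩ cov K m m') : ℝ) + (W (Q ∩ cov K l m') (Q' ∩ cov K m l') : ℝ)) =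
    OmegaG W (cov K l l') (cov K m m') (cov K l m') (cov K m l') h (range K) ∅ ∅ := by
  unfold OmegaG
  refine Finset.sum_congr rfl fun Q _ => Finset.sum_congr rfl fun Q' _ => ?_
  rw [hw_range_eq, hw_range_eq, Finset.empty_union, Finset.empty_union, corePSG_empty, Finset.inter_comm Q, Finset.inter_comm Q',
    Finset.inter_comm Q, Finset.inter_comm Q']
  push_cast; ring

/-- `Ω_W` with the two pairs exchanged. [this work] -/
theorem OmegaG_pairs_comm (W : Finset ℕ → Finset ℕ → ℤ) (A1 B1 A2 B2 : Finset ℕ) (h : ℕ → ℝ) (S Z T : Finset ℕ) :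
    OmegaG W A1 B1 A2 B2 h S Z T = OmegaG W A2 B2 A1 B1 h S Z T := by
  unfold OmegaG corePSG
  refine Finset.sum_congr rfl fun Q _ => Finset.sum_congr rfl fun Q' _ => ?_
  congr 2
  exact Finset.sum_congr rfl fun J _ => add_comm _ _

/-- `Ω_W` (no split hairs) with the two copies exchanged, `W` symmetric. [this work] -/
theorem OmegaG_copies_comm {W : Finset ℕ → Finset ℕ → ℤ} (hWc : ∀ V U, W V U = W U V) (A1 B1 A2 B2 : Finset ℕ) (h : ℕ → ℝ)
    (S Z : Finset ℕ) : OmegaG W A1 B1 A2 B2 h S Z ∅ = OmegaG W B1 A1 B2 A2 h S Z ∅ := by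
  unfold OmegaG
  rw [Finset.sum_comm]
  refine Finset.sum_congr rfl fun Q _ => Finset.sum_congr rfl fun Q' _ => ?_
  rw [corePSG_empty, corePSG_empty, hWc (A1 ∩ _), hWc (A2 ∩ _)]
  ring

/-- **Non-negativity of the hair-averaged double pair sums** for `W` symmetric satisfying the core inequality, all `l, m ≤ K+1`, `l', m' ≤ K`,
`h ∈ [0,1]`. [this work] -/
theorem HHG_nonneg {W : Finset ℕ → Finset ℕ → ℤ}
    (hW : ∀ l m a b : ℕ, m ≤ l → l ≤ K + 1 → a ≤ b → b ≤ K →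
      ∀ Z T : Finset ℕ, Z ⊆ range K → T ⊆ range K → Disjoint Z T →
        0 ≤ (∑ J ∈ T.powerset, W (cov K l a ∩ (Z ∪ J)) (cov K m b ∩ (Z ∪ (T \ J)))) +
          ∑ J ∈ T.powerset, W (cov K l b ∩ (Z ∪ J)) (cov K m a ∩ (Z ∪ (T \ J))))
    (hWc : ∀ V U, W V U = W U V) {h : ℕ → ℝ} (hh : ∀ k, k < K → 0 ≤ h k ∧ h k ≤ 1) {l m l' m' : ℕ} (hl : l ≤ K + 1) (hm : m ≤ K + 1)
    (hl' : l' ≤ K) (hm' : m' ≤ K) :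
    0 ≤ ∑ Q ∈ (range K).powerset, ∑ Q' ∈ (range K).powerset, hairW K h Q * hairW K h Q' *
      ((W (Q ∩ cov K l l') (Q' ∩ cov K m m') : ℝ) + (W (Q ∩ cov K l m') (Q' ∩ cov K m l') : ℝ)) := by
  rw [HHG_eq_OmegaG]
  have R : ∀ {L M α β : ℕ}, M ≤ L → L ≤ K + 1 → α ≤ β → β ≤ K →
      0 ≤ OmegaG W (cov K L α) (cov K M β) (cov K L β) (cov K M α) h (range K) ∅ ∅ :=
    fun hML hL hab hbK => revealG_nonneg hW hh hML hL hab hbK (range K) ∅ ∅ (subset_refl _) (Finset.empty_subset _)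
      (Finset.empty_subset _) (Finset.disjoint_empty_right _) (Finset.disjoint_empty_right _) (Finset.disjoint_empty_right _)
  rcases le_total m l with hml | hlm
  · rcases le_total l' m' with h1 | h1
    · exact R hml hl h1 hm'
    · rw [OmegaG_pairs_comm]; exact R hml hl h1 hl'
  · rw [OmegaG_copies_comm hWc]
    rcases le_total m' l' with h1 | h1
    · exact R hlm hm h1 hl'
    · rw [OmegaG_pairs_comm]; exact R hlm hm h1 hm'

/-- **THE LAW-LEVEL SYMMETRISATION for a general symmetric pair weight**: the core inequality and `g, h ∈ [0,1]` give
`0 ≤ tcE2 K g h W`. [this work] -/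
theorem tcE2_nonneg_of_core {W : Finset ℕ → Finset ℕ → ℤ}
    (hW : ∀ l m a b : ℕ, m ≤ l → l ≤ K + 1 → a ≤ b → b ≤ K →
      ∀ Z T : Finset ℕ, Z ⊆ range K → T ⊆ range K → Disjoint Z T →
        0 ≤ (∑ J ∈ T.powerset, W (cov K l a ∩ (Z ∪ J)) (cov K m b ∩ (Z ∪ (T \ J)))) +
          ∑ J ∈ T.powerset, W (cov K l b ∩ (Z ∪ J)) (cov K m a ∩ (Z ∪ (T \ J))))
    (hWc : ∀ V U, W V U = W U V) {g h : ℕ → ℝ} (hg : ∀ m, m ≤ K → 0 ≤ g m ∧ g m ≤ 1) (hh : ∀ k, k < K → 0 ≤ h k ∧ h k ≤ 1) :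
    0 ≤ tcE2 K g h (fun R R' => (W R R' : ℝ)) := by
  have e1 : tcE2 K g h (fun R R' => (W R R' : ℝ)) =
      ∑ l ∈ range (K + 2), ∑ l' ∈ range (K + 1), ∑ m ∈ range (K + 2), ∑ m' ∈ range (K + 1),
        ∑ Q ∈ (range K).powerset, ∑ Q' ∈ (range K).powerset,
          hairW K h Q * hairW K h Q' * (aL K g l * bM K g l' * (aL K g m * bM K g m')) * (W (Q ∩ cov K l l') (Q' ∩ cov K m m') : ℝ) := by
    unfold tcE2; exact sum_reorder6 _ _ _ _
  have e2 : tcE2 K g h (fun R R' => (W R R' : ℝ)) =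
      ∑ l ∈ range (K + 2), ∑ l' ∈ range (K + 1), ∑ m ∈ range (K + 2), ∑ m' ∈ range (K + 1),
        ∑ Q ∈ (range K).powerset, ∑ Q' ∈ (range K).powerset,
          hairW K h Q * hairW K h Q' * (aL K g l * bM K g l' * (aL K g m * bM K g m')) * (W (Q ∩ cov K l m') (Q' ∩ cov K m l') : ℝ) := by
    unfold tcE2
    rw [sum_relabel6]
    rw [sum_reorder6]
    refine Finset.sum_congr rfl fun l _ => Finset.sum_congr rfl fun l' _ => Finset.sum_congr rfl fun m _ =>
      Finset.sum_congr rfl fun m' _ => Finset.sum_congr rfl fun Q _ => Finset.sum_congr rfl fun Q' _ => by ring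
  have e3 : 2 * tcE2 K g h (fun R R' => (W R R' : ℝ)) =
      ∑ l ∈ range (K + 2), ∑ l' ∈ range (K + 1), ∑ m ∈ range (K + 2), ∑ m' ∈ range (K + 1),
        (aL K g l * bM K g l' * (aL K g m * bM K g m')) *
        ∑ Q ∈ (range K).powerset, ∑ Q' ∈ (range K).powerset, hairW K h Q * hairW K h Q' *
          ((W (Q ∩ cov K l l') (Q' ∩ cov K m m') : ℝ) + (W (Q ∩ cov K l m') (Q' ∩ cov K m l') : ℝ)) := by
    rw [two_mul]
    nth_rewrite 1 [e1]
    rw [e2]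
    simp only [← Finset.sum_add_distrib, Finset.mul_sum]
    refine Finset.sum_congr rfl fun l _ => Finset.sum_congr rfl fun l' _ => Finset.sum_congr rfl fun m _ =>
      Finset.sum_congr rfl fun m' _ => Finset.sum_congr rfl fun Q _ => Finset.sum_congr rfl fun Q' _ => by ring
  have h2 : 0 ≤ 2 * tcE2 K g h (fun R R' => (W R R' : ℝ)) := by
    rw [e3]
    refine Finset.sum_nonneg fun l hl => Finset.sum_nonneg fun l' hl' => Finset.sum_nonneg fun m hm => Finset.sum_nonneg fun m' hm' => ?_
    rw [Finset.mem_range] at hl hl' hm hm'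
    exact mul_nonneg (mul_nonneg (mul_nonneg (aL_nonneg hg l) (bM_nonneg hg (by omega)))
      (mul_nonneg (aL_nonneg hg m) (bM_nonneg hg (by omega)))) (HHG_nonneg hW hWc hh (by omega) (by omega) (by omega) (by omega))
  linarith

end TK

end Summit.CriticalPhenomena.PercolationContinuityZ3.Theorems.HairyCycle

end
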